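import Literature.IUT.LogVolume.Corollary22RatPointDictionary
import Literature.IUT.LogVolume.Corollary22FreyPoint
import HarnessLib

/-!
# D-0079 RESCUE sub-cell R-H, ROUND 2 Q3 — the WITNESS FAMILY `λ_r = r⁸/(r⁸+1)` for «NOT UNIFORMLY»: `j`-invariant, poles, admissibility,
# (P2), (P5) (seat abc-iut-rh2-q3-typ-1 g3; part 1 of 2, consumed by `RHQ3LTailUniformRefutation`)

PROOF-ONLY file (D-0012; 0 definitions, 0 `Prop` facts, no instance, no notation): classical arithmetic of ONE explicit family of rational
points of the `λ`-line, nothing about Θ-data. For a prime `r` the Frey–Legendre point of the (trivial) abc triple `r⁸ + 1 = r⁸ + 1` is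
`λ_r = r⁸/(r⁸+1) ∈ ℚ`; by the tree's Frey formula (`Cor22.jInv_ratPoint_triple`, abc-iut-S6) `j(λ_r) = 2⁸(r¹⁶ + r⁸ + 1)³/(r¹⁶(r⁸+1)²)`, and
with c312-d1's dictionary `Cor22.ord_natCast_eq_factorization` (`ord_v(n) = v_p(n)` at the place `v ∣ p` of `ℚ`):
* §0 `(62·l)⁸ < 2^l ≤ 3^l` for `l ≥ 160` (so `r⁸ + 1 < 3^l` for `r ≤ 62·l`) — elementary (`m + 1 ≤ 2^m`);
* §1 `ord_r j(λ_r) = −16` (`ord_jInv_of_natGenerator_eq`); `ord₂ j(λ_r) ≥ 0`; off the primes of `r¹⁶(r⁸+1)²` no pole; at an odd pole prime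
  `p ≠ r`: `p ∣ r⁸ + 1` and `ord_p j(λ_r) = −2·v_p(r⁸+1)` (`ord_jInv_of_neg_of_ne`); hence `λ_r ∈ U_P` (`mem_UP`), `AdmitsCore` (the four
  exceptional `j` are `r`-integral, `admitsCore`), **(P2)** at every prime `l ≥ 17` with `r⁸ + 1 < 3^l` (`v_p(r⁸+1) < l`, `condP2`) and
  **(P5)** at every prime `l ≠ r` (the place over `r ∤ 2l`, `condP5`) — the hypotheses of `ThetaPartII.stub_thetaData` except (P6)
  (part 2, `RHQ3LTailUniformRefutation` §2).
Nothing here asserts abc, the existence of Θ-data, or any clause of [IUTchIV] Cor. 2.2; no side taken on [IUTchIII] Cor. 3.12 or on any author.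
[cite: Mochizuki2012, IUTchIV Cor. 2.2 (ii) proof (P2)(P5) pp. 45–46, p. 43 (core)] [cite: MochizukiGenEll2010, Ex. 1.3 (i) p. 5, Def. 3.3 p. 12]
[cite: SilvermanAEC2009, Prop. III.1.7(b)] [claim: Mochizuki2012, status: disputed] for every IUT locution.
-/

noncomputable section

open NumberField IsDedekindDomain

namespace Summit.ABC.IUTFork.Repair.RH.Q3LTailSigma8

open Literature.IUT.LogVolume Literature.IUT.LogVolume.Cor22
open Literature.NumberTheory.DiophantineGeometry Literature.NumberTheory.DiophantineGeometry.GenEll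
  Literature.NumberTheory.DiophantineGeometry.UniformABCConjecture Rat.HeightOneSpectrum

namespace UniformWitness

/-! ## §0. Arithmetic: `(62·l)⁸ < 2^l ≤ 3^l` for `l ≥ 160` -/

/-- `(62·l)⁸ < 2^l` for `l ≥ 160` (with `m = ⌊l/16⌋ ≥ 10`: `62·l < 2^{m+10}` by `m + 1 ≤ 2^m`, and `8m + 80 ≤ 16m ≤ l`). [folklore] -/
theorem pow_eight_lt_two_pow {l : ℕ} (hl : 160 ≤ l) : (62 * l) ^ 8 < 2 ^ l := by
  set m := l / 16 with hm
  have hm10 : 10 ≤ m := by omega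
  have h16 : 16 * m ≤ l := by omega
  have hl16 : l < 16 * (m + 1) := by omega
  have h2m : m + 1 ≤ 2 ^ m := Nat.lt_two_pow_self
  have h1 : 62 * l < 2 ^ (m + 10) := by
    calc 62 * l < 62 * (16 * (m + 1)) := Nat.mul_lt_mul_of_pos_left hl16 (by norm_num)
      _ ≤ 1024 * (m + 1) := by omega
      _ ≤ 1024 * 2 ^ m := Nat.mul_le_mul_left _ h2m
      _ = 2 ^ (m + 10) := by rw [pow_add]; ring
  calc (62 * l) ^ 8 < (2 ^ (m + 10)) ^ 8 := Nat.pow_lt_pow_left h1 (by norm_num)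
    _ = 2 ^ (8 * m + 80) := by rw [← pow_mul]; ring_nf
    _ ≤ 2 ^ l := Nat.pow_le_pow_right (by norm_num) (by omega)

/-- `r⁸ + 1 < 3^l` whenever `r ≤ 62·l` and `l ≥ 160`. [folklore] -/
theorem pow_eight_succ_lt_three_pow {r l : ℕ} (hl : 160 ≤ l) (hr : r ≤ 62 * l) : r ^ 8 + 1 < 3 ^ l := by
  have h1 : r ^ 8 ≤ (62 * l) ^ 8 := Nat.pow_le_pow_left hr 8
  have h2 := pow_eight_lt_two_pow hl
  have h3 : 2 ^ l < 3 ^ l := Nat.pow_lt_pow_left (by norm_num) (by omega)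
  omega

/-! ## §1. The Frey–Legendre point `λ_r = r⁸/(r⁸+1)`: `j`-invariant, poles, admissibility, (P2), (P5) -/

section Datum

variable (r : ℕ)

/-- The trivial abc triple `r⁸ + 1 = r⁸ + 1` (`r ≥ 1`). [folklore] -/
theorem isABCTriple_pow_eight (hr : 0 < r) : IsABCTriple (r ^ 8) 1 (r ^ 8 + 1) :=
  ⟨pow_pos hr 8, Nat.one_pos, rfl, Nat.coprime_one_right _⟩

/-- `j(λ_r) = 2⁸((r⁸+1)·1 + r⁸·r⁸)³ / (r⁸·1·(r⁸+1))²` (the tree's Frey formula `Cor22.jInv_ratPoint_triple`). [cite: SilvermanAEC2009, Prop. III.1.7(b)] -/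
theorem jInv_eq (hr : 0 < r) :
    jInv (((r ^ 8 : ℕ) : ℚ) / ((r ^ 8 + 1 : ℕ) : ℚ)) =
      ((256 * ((r ^ 8 + 1) * 1 + r ^ 8 * r ^ 8) ^ 3 : ℕ) : ℚ) / ((((r ^ 8 * 1 * (r ^ 8 + 1)) ^ 2 : ℕ)) : ℚ) :=
  jInv_ratPoint_triple (isABCTriple_pow_eight r hr)

/-- The numerator `2⁸(r¹⁶ + r⁸ + 1)³` is nonzero. [folklore] -/
theorem num_ne_zero : (256 * ((r ^ 8 + 1) * 1 + r ^ 8 * r ^ 8) ^ 3 : ℕ) ≠ 0 := by positivity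

/-- The denominator `(r⁸(r⁸+1))²` is nonzero (`r ≥ 1`). [folklore] -/
theorem den_ne_zero (hr : 0 < r) : ((r ^ 8 * 1 * (r ^ 8 + 1)) ^ 2 : ℕ) ≠ 0 := by positivity

/-- **The dictionary**: `ord_v j(λ_r) = v_p(N) − v_p(D)` at the place `v` of `ℚ` over `p`, `N = 2⁸(r¹⁶+r⁸+1)³`, `D = (r⁸(r⁸+1))²`
(`ord_v(n) = v_p(n)`, c312-d1's `Cor22.ord_natCast_eq_factorization`). [cite: MochizukiGenEll2010, Def. 3.3 p. 12] -/
theorem ord_jInv_eq (hr : 0 < r) (v : HeightOneSpectrum (𝓞 ℚ)) :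
    ord ℚ v (jInv (((r ^ 8 : ℕ) : ℚ) / ((r ^ 8 + 1 : ℕ) : ℚ))) =
      ((256 * ((r ^ 8 + 1) * 1 + r ^ 8 * r ^ 8) ^ 3 : ℕ).factorization (natGenerator v) : ℤ) -
        ((((r ^ 8 * 1 * (r ^ 8 + 1)) ^ 2 : ℕ)).factorization (natGenerator v) : ℤ) := by
  have hN0 : (((256 * ((r ^ 8 + 1) * 1 + r ^ 8 * r ^ 8) ^ 3 : ℕ)) : ℚ) ≠ 0 := by exact_mod_cast num_ne_zero r
  have hD0 : ((((r ^ 8 * 1 * (r ^ 8 + 1)) ^ 2 : ℕ)) : ℚ) ≠ 0 := by exact_mod_cast den_ne_zero r hr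
  rw [jInv_eq r hr, div_eq_mul_inv, ord_mul ℚ v hN0 (inv_ne_zero hD0), ord_inv, ord_natCast_eq_factorization v (num_ne_zero r),
    ord_natCast_eq_factorization v (den_ne_zero r hr)]
  ring

/-- `v_r(D) = 16` for an odd prime `r` (`D = r¹⁶·(r⁸+1)²`, `r ∤ r⁸+1`). [folklore] -/
theorem factorization_den_self (hr : r.Prime) :
    (((r ^ 8 * 1 * (r ^ 8 + 1)) ^ 2 : ℕ)).factorization r = 16 := by
  have hr0 : r ≠ 0 := hr.ne_zero
  have hc0 : r ^ 8 + 1 ≠ 0 := by positivity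
  have hD : ((r ^ 8 * 1 * (r ^ 8 + 1)) ^ 2 : ℕ) = r ^ 16 * (r ^ 8 + 1) ^ 2 := by ring
  have hndvd : ¬ r ∣ r ^ 8 + 1 := fun h =>
    hr.not_dvd_one ((Nat.dvd_add_right (dvd_pow_self r (by norm_num : (8 : ℕ) ≠ 0))).1 h)
  rw [hD, Nat.factorization_mul (pow_ne_zero _ hr0) (pow_ne_zero _ hc0), Finsupp.add_apply, Nat.factorization_pow, Nat.factorization_pow,
    Finsupp.smul_apply, Finsupp.smul_apply, hr.factorization_self, Nat.factorization_eq_zero_of_not_dvd hndvd]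
  simp

/-- `v_r(N) = 0` for an odd prime `r` (`N = 2⁸(r¹⁶+r⁸+1)³ ≡ 2⁸ (mod r)`). [folklore] -/
theorem factorization_num_self (hr : r.Prime) (hr2 : r ≠ 2) :
    (256 * ((r ^ 8 + 1) * 1 + r ^ 8 * r ^ 8) ^ 3 : ℕ).factorization r = 0 := by
  apply Nat.factorization_eq_zero_of_not_dvd
  intro h
  rcases (Nat.Prime.dvd_mul hr).1 h with h256 | h3
  · have : r ∣ 2 := Nat.Prime.dvd_of_dvd_pow hr (show r ∣ 2 ^ 8 by simpa using h256)
    exact hr2 ((Nat.prime_dvd_prime_iff_eq hr Nat.prime_two).1 this)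
  · have h1 : r ∣ (r ^ 8 + 1) * 1 + r ^ 8 * r ^ 8 := Nat.Prime.dvd_of_dvd_pow hr h3
    have h2 : r ∣ r ^ 8 * (1 + r ^ 8) := Dvd.dvd.mul_right (dvd_pow_self r (by norm_num)) _
    have h3 : (r ^ 8 + 1) * 1 + r ^ 8 * r ^ 8 = r ^ 8 * (1 + r ^ 8) + 1 := by ring
    rw [h3] at h1
    exact hr.not_dvd_one ((Nat.dvd_add_right h2).1 h1)

/-- `v_p(N) = 0` at an odd prime `p ∣ r⁸ + 1` (`r¹⁶ + r⁸ + 1 = r⁸(r⁸+1) + 1 ≡ 1 (mod p)`). [folklore] -/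
theorem factorization_num_of_dvd {p : ℕ} (hp : p.Prime) (hp2 : p ≠ 2) (hpd : p ∣ r ^ 8 + 1) :
    (256 * ((r ^ 8 + 1) * 1 + r ^ 8 * r ^ 8) ^ 3 : ℕ).factorization p = 0 := by
  apply Nat.factorization_eq_zero_of_not_dvd
  intro h
  rcases (Nat.Prime.dvd_mul hp).1 h with h256 | h3
  · have : p ∣ 2 := Nat.Prime.dvd_of_dvd_pow hp (show p ∣ 2 ^ 8 by simpa using h256)
    exact hp2 ((Nat.prime_dvd_prime_iff_eq hp Nat.prime_two).1 this)
  · have h1 : p ∣ (r ^ 8 + 1) * 1 + r ^ 8 * r ^ 8 := Nat.Prime.dvd_of_dvd_pow hp h3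
    have h2 : p ∣ r ^ 8 * (r ^ 8 + 1) := Dvd.dvd.mul_left hpd _
    have h3 : (r ^ 8 + 1) * 1 + r ^ 8 * r ^ 8 = r ^ 8 * (r ^ 8 + 1) + 1 := by ring
    rw [h3] at h1
    exact hp.not_dvd_one ((Nat.dvd_add_right h2).1 h1)

/-- `v_p(D) = 2·v_p(r⁸+1)` at a prime `p ≠ r`. [folklore] -/
theorem factorization_den_of_ne (hr : r.Prime) {p : ℕ} (hp : p.Prime) (hpr : p ≠ r) :
    (((r ^ 8 * 1 * (r ^ 8 + 1)) ^ 2 : ℕ)).factorization p = 2 * (r ^ 8 + 1).factorization p := by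
  have hr0 : r ≠ 0 := hr.ne_zero
  have hc0 : r ^ 8 + 1 ≠ 0 := by positivity
  have hD : ((r ^ 8 * 1 * (r ^ 8 + 1)) ^ 2 : ℕ) = r ^ 16 * (r ^ 8 + 1) ^ 2 := by ring
  have hpr' : ¬ p ∣ r := fun h => hpr ((Nat.prime_dvd_prime_iff_eq hp hr).1 h)
  rw [hD, Nat.factorization_mul (pow_ne_zero _ hr0) (pow_ne_zero _ hc0), Finsupp.add_apply, Nat.factorization_pow, Nat.factorization_pow,
    Finsupp.smul_apply, Finsupp.smul_apply, Nat.factorization_eq_zero_of_not_dvd hpr']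
  simp

/-- **Pole of order `16` at `r`**: `ord_v j(λ_r) = −16` at the place over the odd prime `r`. [cite: MochizukiGenEll2010, Def. 3.3 p. 12] -/
theorem ord_jInv_of_natGenerator_eq (hr : r.Prime) (hr2 : r ≠ 2) (v : HeightOneSpectrum (𝓞 ℚ)) (hv : natGenerator v = r) :
    ord ℚ v (jInv (((r ^ 8 : ℕ) : ℚ) / ((r ^ 8 + 1 : ℕ) : ℚ))) = -16 := by
  rw [ord_jInv_eq r hr.pos v, hv, factorization_num_self r hr hr2, factorization_den_self r hr]
  norm_num

/-- `ord₂ j(λ_r) ≥ 0` for odd `r` (`2⁸ ∣ N`, `v₂(D) = 2·v₂(r⁸+1) = 2` as `r⁸ + 1 ≡ 2 (mod 4)`). [folklore] -/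
theorem ord_jInv_nonneg_of_two (hr : r.Prime) (hr2 : r ≠ 2) (v : HeightOneSpectrum (𝓞 ℚ)) (hv : natGenerator v = 2) :
    0 ≤ ord ℚ v (jInv (((r ^ 8 : ℕ) : ℚ) / ((r ^ 8 + 1 : ℕ) : ℚ))) := by
  rw [ord_jInv_eq r hr.pos v, hv, factorization_den_of_ne r hr Nat.prime_two (Ne.symm hr2)]
  have h8 : 8 ≤ (256 * ((r ^ 8 + 1) * 1 + r ^ 8 * r ^ 8) ^ 3 : ℕ).factorization 2 := by
    rw [← Nat.Prime.pow_dvd_iff_le_factorization Nat.prime_two (num_ne_zero r)]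
    exact Dvd.intro _ rfl
  have hodd : Odd r := hr.odd_of_ne_two hr2
  have h4 : ¬ 2 ^ 2 ∣ r ^ 8 + 1 := by
    intro h
    have h' : 4 ∣ r ^ 8 + 1 := by simpa using h
    obtain ⟨k, hk⟩ := hodd
    have : r ^ 8 + 1 = (2 * k + 1) ^ 8 + 1 := by rw [hk]
    rw [this] at h'
    have hmod : ((2 * k + 1) ^ 8 + 1) % 4 = 2 := by
      have h2 : (2 * k + 1) ^ 2 = 4 * (k ^ 2 + k) + 1 := by ring
      have : (2 * k + 1) ^ 8 = ((2 * k + 1) ^ 2) ^ 4 := by ring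
      rw [this, h2]
      have h3 : (4 * (k ^ 2 + k) + 1) ^ 4 = 4 * ((k ^ 2 + k) * (64 * (k ^ 2 + k) ^ 3 + 64 * (k ^ 2 + k) ^ 2 + 24 * (k ^ 2 + k) + 4)) + 1 := by ring
      rw [h3]; omega
    omega
  have h2le : (r ^ 8 + 1).factorization 2 ≤ 1 := by
    by_contra hcon
    push Not at hcon
    exact h4 ((Nat.Prime.pow_dvd_iff_le_factorization Nat.prime_two (by positivity)).2 hcon)
  omega

/-- Off the primes of `D`: `ord_v j(λ_r) ≥ 0`. [cite: MochizukiGenEll2010, Def. 3.3 p. 12] -/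
theorem ord_jInv_nonneg_of_not_dvd (hr : 0 < r) (v : HeightOneSpectrum (𝓞 ℚ)) (hv : ¬ natGenerator v ∣ ((r ^ 8 * 1 * (r ^ 8 + 1)) ^ 2 : ℕ)) :
    0 ≤ ord ℚ v (jInv (((r ^ 8 : ℕ) : ℚ) / ((r ^ 8 + 1 : ℕ) : ℚ))) := by
  rw [ord_jInv_eq r hr v, Nat.factorization_eq_zero_of_not_dvd hv]
  push_cast
  linarith [Nat.zero_le ((256 * ((r ^ 8 + 1) * 1 + r ^ 8 * r ^ 8) ^ 3 : ℕ).factorization (natGenerator v))]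

/-- **The poles at odd `p ≠ r`**: if `ord_v j(λ_r) < 0` at the place over `p ∉ {2, r}` then `p ∣ r⁸ + 1` and `ord_v j(λ_r) = −2·v_p(r⁸+1)`.
[cite: MochizukiGenEll2010, Def. 3.3 p. 12] -/
theorem ord_jInv_of_neg_of_ne (hr : r.Prime) (v : HeightOneSpectrum (𝓞 ℚ)) (h2 : natGenerator v ≠ 2) (hvr : natGenerator v ≠ r)
    (hneg : ord ℚ v (jInv (((r ^ 8 : ℕ) : ℚ) / ((r ^ 8 + 1 : ℕ) : ℚ))) < 0) :
    natGenerator v ∣ r ^ 8 + 1 ∧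
      ord ℚ v (jInv (((r ^ 8 : ℕ) : ℚ) / ((r ^ 8 + 1 : ℕ) : ℚ))) = -(2 * ((r ^ 8 + 1).factorization (natGenerator v) : ℕ) : ℤ) := by
  have hp : (natGenerator v).Prime := prime_natGenerator v
  have hdvdD : natGenerator v ∣ ((r ^ 8 * 1 * (r ^ 8 + 1)) ^ 2 : ℕ) := by
    by_contra h
    exact absurd hneg (not_lt.2 (ord_jInv_nonneg_of_not_dvd r hr.pos v h))
  have hdvd : natGenerator v ∣ r ^ 8 + 1 := by
    have h1 : natGenerator v ∣ r ^ 8 * 1 * (r ^ 8 + 1) := Nat.Prime.dvd_of_dvd_pow hp hdvdD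
    rcases (Nat.Prime.dvd_mul hp).1 h1 with h2' | h3
    · rw [mul_one] at h2'
      exact absurd ((Nat.prime_dvd_prime_iff_eq hp hr).1 (Nat.Prime.dvd_of_dvd_pow hp h2')) hvr
    · exact h3
  refine ⟨hdvd, ?_⟩
  rw [ord_jInv_eq r hr.pos v, factorization_num_of_dvd r hp h2 hdvd, factorization_den_of_ne r hr hp hvr]
  push_cast
  ring

/-- `λ_r ∈ U_P(ℚ)` (minimally presented, `λ_r ∉ {0, 1}`). [cite: MochizukiGenEll2010, Ex 1.3 (i) p.5] -/
theorem mem_UP (hr : 0 < r) : ratPoint (((r ^ 8 : ℕ) : ℚ) / ((r ^ 8 + 1 : ℕ) : ℚ)) ∈ UP := by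
  have ha : (0 : ℚ) < ((r ^ 8 : ℕ) : ℚ) := by exact_mod_cast pow_pos hr 8
  have hc : ((r ^ 8 : ℕ) : ℚ) < ((r ^ 8 + 1 : ℕ) : ℚ) := by exact_mod_cast Nat.lt_succ_self _
  refine (ratPoint_mem_UPle_one (div_pos ha (ha.trans hc)).ne' ?_).1
  rw [Ne, div_eq_one_iff_eq (ha.trans hc).ne']
  exact hc.ne

/-- The place of `ℚ` over the prime `r`, by name. [folklore] -/
theorem natGenerator_primesEquiv_symm (hr : r.Prime) : natGenerator ((primesEquiv (R := 𝓞 ℚ)).symm ⟨r, hr⟩) = r :=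
  congrArg Subtype.val ((primesEquiv (R := 𝓞 ℚ)).apply_symm_apply ⟨r, hr⟩)

/-- **`AdmitsCore`**: `j(λ_r)` is none of the four exceptional values — it has a pole at the prime `r ≥ 7`, where `2¹⁴31³/5³`, `2²73³/3⁴`,
`1728`, `0` are `r`-integral. [cite: Mochizuki2012, IUTchIV Cor. 2.2 (ii) proof p. 43] -/
theorem admitsCore (hr : r.Prime) (hr7 : 7 ≤ r) : AdmitsCore (ratPoint (((r ^ 8 : ℕ) : ℚ) / ((r ^ 8 + 1 : ℕ) : ℚ))) := by
  intro q hq heq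
  set v : HeightOneSpectrum (𝓞 ℚ) := (primesEquiv (R := 𝓞 ℚ)).symm ⟨r, hr⟩ with hvdef
  have hgen : natGenerator v = r := natGenerator_primesEquiv_symm r hr
  have hord := ord_jInv_of_natGenerator_eq r hr (by omega) v hgen
  change jInv (((r ^ 8 : ℕ) : ℚ) / ((r ^ 8 + 1 : ℕ) : ℚ)) = q at heq
  rw [heq] at hord
  -- `ord_v` of each exceptional value is `≥ 0`
  have hnat : ∀ n : ℕ, 0 ≤ ord ℚ v (n : ℚ) := by
    intro n
    rcases eq_or_ne n 0 with rfl | hn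
    · simp [ord_zero]
    · rw [ord_natCast_eq_factorization v hn]; positivity
  have hden : ∀ {p k : ℕ}, p.Prime → p ≠ r → ord ℚ v ((p ^ k : ℕ) : ℚ) = 0 := by
    intro p k hp hpr
    rw [ord_natCast_eq_factorization v (pow_ne_zero _ hp.ne_zero), hgen, Nat.factorization_pow, Finsupp.smul_apply,
      Nat.factorization_eq_zero_of_not_dvd (fun h => hpr ((Nat.prime_dvd_prime_iff_eq hr hp).1 h).symm)]
    simp
  simp only [coreExceptionalJ, Finset.mem_insert, Finset.mem_singleton] at hq
  rcases hq with rfl | rfl | rfl | rfl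
  · have h : ((488095744 / 125 : ℚ) : ℚ) = ((488095744 : ℕ) : ℚ) * (((5 ^ 3 : ℕ) : ℚ))⁻¹ := by norm_num
    rw [h, ord_mul ℚ v (by norm_num) (by norm_num), ord_inv, hden (by norm_num) (by omega)] at hord
    linarith [hnat 488095744]
  · have h : ((1556068 / 81 : ℚ) : ℚ) = ((1556068 : ℕ) : ℚ) * (((3 ^ 4 : ℕ) : ℚ))⁻¹ := by norm_num
    rw [h, ord_mul ℚ v (by norm_num) (by norm_num), ord_inv, hden (by norm_num) (by omega)] at hord
    linarith [hnat 1556068]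
  · have h : ((1728 : ℚ) : ℚ) = ((1728 : ℕ) : ℚ) := by norm_num
    rw [h] at hord
    linarith [hnat 1728]
  · have h : ((0 : ℚ) : ℚ) = 0 := by norm_num
    rw [h, ord_zero] at hord
    norm_num at hord

/-- **(P2) at `l`** for a prime `l ≥ 17` with `r⁸ + 1 < 3^l`: `l` divides no nonzero local height of `λ_r` — the heights are `16` (at `r`) and
`2·v_p(r⁸+1)` with `1 ≤ v_p(r⁸+1) < l` (at odd `p ∣ r⁸+1`). [cite: Mochizuki2012, IUTchIV Cor. 2.2 (ii) proof (P2) p. 45] -/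
theorem condP2 (hr : r.Prime) (hr2 : r ≠ 2) {l : ℕ} (hl : l.Prime) (hl17 : 17 ≤ l) (h3l : r ^ 8 + 1 < 3 ^ l) :
    CondP2 (ratPoint (((r ^ 8 : ℕ) : ℚ) / ((r ^ 8 + 1 : ℕ) : ℚ))) l := by
  -- stated over `HeightOneSpectrum (𝓞 ℚ)` verbatim, then transported to the point's presentation field by `exact`
  have key : ∀ v : HeightOneSpectrum (𝓞 ℚ), ord ℚ v (jInv (((r ^ 8 : ℕ) : ℚ) / ((r ^ 8 + 1 : ℕ) : ℚ))) < 0 →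
      ¬ ((l : ℤ) ∣ ord ℚ v (jInv (((r ^ 8 : ℕ) : ℚ) / ((r ^ 8 + 1 : ℕ) : ℚ)))) := by
    intro v hneg hdvd
    by_cases hvr : natGenerator v = r
    · rw [ord_jInv_of_natGenerator_eq r hr hr2 v hvr] at hdvd
      have h16 : l ∣ 16 := by
        have : (l : ℤ) ∣ ((16 : ℕ) : ℤ) := by simpa using hdvd
        exact_mod_cast this
      have := Nat.le_of_dvd (by norm_num) h16
      omega
    by_cases hv2 : natGenerator v = 2
    · exact absurd hneg (not_lt.2 (ord_jInv_nonneg_of_two r hr hr2 v hv2))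
    obtain ⟨hpd, hord⟩ := ord_jInv_of_neg_of_ne r hr v hv2 hvr hneg
    set p := natGenerator v with hpdef
    have hp : p.Prime := prime_natGenerator v
    set t := (r ^ 8 + 1).factorization p with htdef
    rw [hord] at hdvd
    have hlt : l ∣ 2 * t := by
      have h' : (l : ℤ) ∣ ((2 * t : ℕ) : ℤ) := by
        have := (dvd_neg (α := ℤ)).2 hdvd
        push_cast at this ⊢
        simpa using this
      exact_mod_cast h'
    have hl2 : Nat.Coprime l 2 := (Nat.coprime_primes hl Nat.prime_two).2 (by omega)
    have hlt' : l ∣ t := hl2.dvd_of_dvd_mul_left hlt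
    have ht1 : 1 ≤ t := by
      rw [htdef, ← Nat.Prime.pow_dvd_iff_le_factorization hp (by positivity), pow_one]
      exact hpd
    have hle : l ≤ t := Nat.le_of_dvd ht1 hlt'
    -- `3^l ≤ 3^t ≤ p^t ≤ r⁸ + 1 < 3^l`
    have hp3 : 3 ≤ p := by
      have h2 := hp.two_le
      omega
    have hpt : p ^ t ∣ r ^ 8 + 1 := Nat.ordProj_dvd _ _
    have h1 : p ^ t ≤ r ^ 8 + 1 := Nat.le_of_dvd (by positivity) hpt
    have h2 : 3 ^ t ≤ p ^ t := Nat.pow_le_pow_left hp3 t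
    have h3 : 3 ^ l ≤ 3 ^ t := Nat.pow_le_pow_right (by norm_num) hle
    omega
  intro v hneg
  exact key v hneg

/-- **(P5) at `l`**: the place over `r` is bad and divides neither `2` nor `l` (`r` odd, `r ≠ l`). [cite: Mochizuki2012, IUTchIV Cor. 2.2 (ii) proof (P5) p. 46] -/
theorem condP5 (hr : r.Prime) (hr2 : r ≠ 2) {l : ℕ} (hl : l.Prime) (hrl : r ≠ l) :
    CondP5 (ratPoint (((r ^ 8 : ℕ) : ℚ) / ((r ^ 8 + 1 : ℕ) : ℚ))) l := by
  have key : ∃ w : HeightOneSpectrum (𝓞 ℚ), ord ℚ w (jInv (((r ^ 8 : ℕ) : ℚ) / ((r ^ 8 + 1 : ℕ) : ℚ))) < 0 ∧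
      ((2 : ℕ) : 𝓞 ℚ) ∉ w.asIdeal ∧ ((l : ℕ) : 𝓞 ℚ) ∉ w.asIdeal := by
    refine ⟨(primesEquiv (R := 𝓞 ℚ)).symm ⟨r, hr⟩, ?_, ?_, ?_⟩
    · rw [ord_jInv_of_natGenerator_eq r hr hr2 _ (natGenerator_primesEquiv_symm r hr)]
      norm_num
    · rw [natCast_mem_asIdeal_iff, natGenerator_primesEquiv_symm r hr]
      intro h
      exact hr2 ((Nat.prime_dvd_prime_iff_eq hr Nat.prime_two).1 h)
    · rw [natCast_mem_asIdeal_iff, natGenerator_primesEquiv_symm r hr]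
      intro h
      exact hrl ((Nat.prime_dvd_prime_iff_eq hr hl).1 h)
  obtain ⟨w, h1, h2, h3⟩ := key
  exact ⟨w, h1, h2, h3⟩

end Datum

end UniformWitness

end Summit.ABC.IUTFork.Repair.RH.Q3LTailSigma8

end
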